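import Literature.Combinatorics.AssociationSchemes.MatchingLevelInequality
import Literature.Combinatorics.AssociationSchemes.JohnsonSpectrum
import Literature.Combinatorics.SetFamily.SpreadApproximation
import Literature.Barriers.PneNP.TSPExtensionComplexityRothvossAssembly
import Literature.Barriers.PneNP.TSPExtensionComplexityMatchingsOps
import HarnessLib

/-!
# Homogeneous families of perfect matchings: edge sets ↔ partner involutions, and the matching-side
# level-`k` inequality in Kupavskii–Zakharov's and the kernel's currency

Cell pnp-psdrank (summit PneNP, rung F-N2, route `ChebyshevTracialDesign`, crux stmt-PneNP-19878), step S4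
of the `r = 1` rung (planner p1 N2-SpreadStructure §SNT; prover R1-SKELETON S1/S4). Three currencies for one
object — a perfect matching of `K_n` — meet in S4:

* EDGE SETS `M : Finset (Sym2 (Fin n))` with `IsPMOn univ M` / `perfectMatchings univ` / `PMatch n`
  (`Literature/Barriers/PneNP/TSPExtensionComplexityMatchings.lean`, Rothvoß's slack matrix, the kernel files'
  `M.2.partner`, and the ambient family `𝒜 = perfectMatchings univ` of the Kupavskii–Zakharov spread
  approximation `Literature/Combinatorics/SetFamily/SpreadApproximation.lean` = step S1, whose pieces are
  `(𝒜, τ)`-homogeneous edge-set families, `IsRelHomogeneous`);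
* PARTNER INVOLUTIONS `π ∈ fpfInvolutions n ⊆ Perm (Fin n)` (the currency of the matching-side level-`k`
  inequality «(F2)», `Literature/Combinatorics/AssociationSchemes/MatchingLevelInequality.lean`, whose
  homogeneity hypothesis `IsHomogeneousMatchingFamily τ Y` tests partial matchings as partner maps).

This module is the dictionary, so that (F2) can be fed the output of S1 and read in the kernel's form:
* §1 `permOf M` (partner permutation of an edge set; junk `1` off perfect matchings) and `edgesOf π` are
  inverse bijections `perfectMatchings univ ↔ fpfInvolutions n` (`permOf_edgesOf`, `edgesOf_permOf`,
  `image_permOf_perfectMatchings`, `card_perfectMatchings_eq`; sums transport, `sum_image_permOf`);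
* §2 stars: a partial matching in partner form `(D, φ)` has the edge set `pmEdges D φ` (`|D| = 2|pmEdges D φ|`),
  and `pmEdges D φ ⊆ M ↔ ∀ x ∈ D, permOf M x = φ x`; conversely every edge set `S` contained in some perfect
  matching is `pmEdges (verts S) (permOf M)` for any perfect matching `M ⊇ S`;
* §3 **`IsRelHomogeneous τ (perfectMatchings univ) ℱ → IsHomogeneousMatchingFamily τ (ℱ.image permOf)`** and the
  converse for `τ ≥ 0` (`isRelHomogeneous_iff_isHomogeneousMatchingFamily`): Kupavskii–Zakharov `τ`-homogeneity
  of a family of perfect matchings [cite: KupavskiiZakharov2022, §2] is literally the same condition in the two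
  currencies (sets `S` extending to no perfect matching contribute `0 ≤ 0`);
* §4 **(F2) in edge-set currency** `closedSum_sq_le_of_relHomogeneous` — for `ℱ ⊆ perfectMatchings univ`
  `(𝒜, τ)`-homogeneous, `ν = |ℱ|/|𝒜|`, `p` harmonic of degree `k`, `1 ≤ k ≤ min(⅛ log(1/ν), 10⁻⁵ n)`:
  `(Σ_{M ∈ ℱ} Π_p(M))² ≤ ν² (C τ² k⁻¹ log(1/ν))^k · |𝒜| · Σ_{M ∈ 𝒜} Π_p(M)²` modulo the named fact
  `GlobalLevelDInequality` (Keevash–Lifshitz Thm 1.8), with NO reference matching in the statement — and the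
  `PMatch n` form `pmatch_closedSum_sq_le` with the functional written `Σ_{T : #{x ∈ T : M.partner x ∈ T} = k} p_T`
  exactly as in the kernel's bi-mode expansion (`…ChebyshevTracialDesignRectangleBiMode`);
* §5 the matching-side NORM: the number of perfect matchings for which two `k`-sets `T, T'` are both closed is a
  class function of `|T ∩ T'|` (`S_n` is transitive on pairs of `k`-sets with given intersection size,
  `exists_perm_image_pair_eq`; conjugation invariance), hence by the spectral theorem of the Johnson scheme
  (`JohnsonSpectrum.sum_sq_gram_ladder`) **`Σ_{π ∈ PM_n} Π_p(π)² = kernelEigen n k k κ · Σ_T p_T²`** for harmonic `p`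
  of degree `k`, `κ = closedPairProfile n k` (`sum_closedSum_sq_eq`), and on the top layer
  `kernelEigen n k k κ = Σ_{i ≤ k} (−1)^{k−i} C(k,i) κ(i)` (`kernelEigen_top`); the explicit profile
  `κ(i) = pm(i)·pm(k−i)²·pm(n−2k+i)` is the kernel's `…ChebyshevTracialDesignClosedPairCount.card_filter_closed_closed`
  (general-`p` twin of `…ChebyshevTracialDesignDipoleSquareSum.sum_sq_dipoleFunctional`).
  [cite: GodsilMeagher2015, §15.2 (perfect matching scheme)]

* §6 (appended) LINKS OF MATCHING FAMILIES = the homogeneity bookkeeping of S2 (reduced instance): for a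
  partial matching `S` of `D ⊆ V`, **`link (perfectMatchings V) S = perfectMatchings (V ∖ D)`** (KZ's link
  `𝒜(S)` [cite: KupavskiiZakharov2022, §2 (p. 6)] of the ambient family is the ambient family of the reduced vertex
  set), so a Kupavskii–Zakharov piece `ℱ_i ⊆ 𝒜(S_i)` has a link that is `(PM(V ∖ D_i), τ)`-homogeneous
  (`isRelHomogeneous_link_perfectMatchings`, from `SpreadApproximation`'s `IsRelHomogeneous.link` = Lemma 11 (ii)
  in link form), transported to any relabelled vertex set by `isRelHomogeneous_perfectMatchings_image`; `K_n`
  packaging `isRelHomogeneous_link_univ` (support `verts S`, `isPMOn_verts`). After these three rewrites §4 applies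
  in the reduced instance.

Everything is proved; no new named fact. presearch: the edge-set/partner-map dictionary and the homogeneity
bookkeeping are folklore (KZ state homogeneity for arbitrary set families [cite: KupavskiiZakharov2022, §2]);
no source treats level inequalities for the perfect-matching scheme (LIT-14 §5). WHAT THIS IS NOT: no proof of
Keevash–Lifshitz Thm 1.8; not S1/S2/S4 themselves; nothing about psd rank; no P-vs-NP content.
-/

noncomputable section

namespace Literature.Combinatorics.AssociationSchemes.HomogeneousMatchingFamilies

open Finset Equiv
open Literature.Barriers.PneNP
open Literature.Combinatorics.SetFamily
open Literature.Combinatorics.AssociationSchemes.JohnsonHarmonics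
open Literature.Combinatorics.AssociationSchemes.JohnsonSpectrum
open Literature.Combinatorics.AssociationSchemes.MatchingLevelInequality
open Literature.Combinatorics.Additive.KeevashLifshitz

variable {n : ℕ}

/-! ## §1 Perfect matchings: edge sets ↔ fixed-point-free involutions -/

/-- **The partner permutation of an edge set**: for a perfect matching `M` of `Fin n` the map sending each
vertex to its partner (an involution without fixed points); the identity permutation (junk) if `M` is not a
perfect matching. [cite: Rothvoss2017, §2 (PDF p. 6)] -/
def permOf (M : Finset (Sym2 (Fin n))) : Perm (Fin n) :=
  if h : IsPMOn (univ : Finset (Fin n)) M then Function.Involutive.toPerm h.partner h.partner_partner else 1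

/-- On a perfect matching, `permOf M` is the partner map. [cite: Rothvoss2017, §2 (PDF p. 6)] -/
theorem permOf_apply {M : Finset (Sym2 (Fin n))} (hM : IsPMOn (univ : Finset (Fin n)) M) (x : Fin n) :
    permOf M x = hM.partner x := by
  unfold permOf
  rw [dif_pos hM]
  rfl

/-- `{x, permOf M x} ∈ M`. [cite: Rothvoss2017, §2 (PDF p. 6: `𝓜_all`, perfect matchings as edge sets)] -/
theorem mk_permOf_mem {M : Finset (Sym2 (Fin n))} (hM : IsPMOn (univ : Finset (Fin n)) M) (x : Fin n) :
    s(x, permOf M x) ∈ M := by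
  rw [permOf_apply hM]
  exact hM.mk_partner_mem x

/-- The partner is the only neighbour: `{x, y} ∈ M → permOf M x = y`. [cite: Rothvoss2017, §2 (PDF p. 6: `𝓜_all`, perfect matchings as edge sets)] -/
theorem permOf_eq_of_mem {M : Finset (Sym2 (Fin n))} (hM : IsPMOn (univ : Finset (Fin n)) M) {x y : Fin n}
    (h : s(x, y) ∈ M) : permOf M x = y := by
  rw [permOf_apply hM]
  exact (hM.eq_partner_of_mem h).symm

/-- `permOf M` is an involution. [cite: GodsilMeagher2015, §15.4 (PDF p. 228: perfect matchings of `K_{2k}` ↔ cosets `Sym(2k)/(Sym(2) ≀ Sym(k))`)] -/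
theorem permOf_permOf {M : Finset (Sym2 (Fin n))} (hM : IsPMOn (univ : Finset (Fin n)) M) (x : Fin n) :
    permOf M (permOf M x) = x := by
  rw [permOf_apply hM, permOf_apply hM]
  exact hM.partner_partner x

/-- `permOf M` has no fixed point. [cite: GodsilMeagher2015, §15.4 (PDF p. 228: perfect matchings of `K_{2k}` ↔ cosets `Sym(2k)/(Sym(2) ≀ Sym(k))`)] -/
theorem permOf_ne {M : Finset (Sym2 (Fin n))} (hM : IsPMOn (univ : Finset (Fin n)) M) (x : Fin n) :
    permOf M x ≠ x := by
  rw [permOf_apply hM]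
  exact hM.partner_ne x

/-- The partner permutation of a perfect matching is a fixed-point-free involution.
[cite: Rothvoss2017, §2 (PDF p. 6)] -/
theorem permOf_mem_fpfInvolutions {M : Finset (Sym2 (Fin n))} (hM : IsPMOn (univ : Finset (Fin n)) M) :
    permOf M ∈ fpfInvolutions n := by
  rw [mem_fpfInvolutions]
  refine ⟨?_, permOf_ne hM⟩
  ext x
  rw [Perm.mul_apply, permOf_permOf hM]
  rfl

/-- **The edge set of a permutation**: `{{x, π x} : x}` (a perfect matching when `π` is a fixed-point-free
involution). [cite: Rothvoss2017, §2 (PDF p. 6)] -/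
def edgesOf (π : Perm (Fin n)) : Finset (Sym2 (Fin n)) := univ.image fun x => s(x, π x)

/-- Membership in `edgesOf π`. [cite: Rothvoss2017, §2 (PDF p. 6: `𝓜_all`, perfect matchings as edge sets)] -/
theorem mem_edgesOf {π : Perm (Fin n)} {e : Sym2 (Fin n)} : e ∈ edgesOf π ↔ ∃ x, s(x, π x) = e := by
  simp [edgesOf]

/-- For a fixed-point-free involution, `{x, y}` is an edge iff `y = π x`. [cite: Rothvoss2017, §2 (PDF p. 6: `𝓜_all`, perfect matchings as edge sets)] -/
theorem mk_mem_edgesOf_iff {π : Perm (Fin n)} (hπ : π ∈ fpfInvolutions n) {x y : Fin n} :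
    s(x, y) ∈ edgesOf π ↔ y = π x := by
  rw [mem_edgesOf]
  constructor
  · rintro ⟨z, hz⟩
    rcases Sym2.eq_iff.1 hz with ⟨h1, h2⟩ | ⟨h1, h2⟩
    · rw [← h1, ← h2]
    · -- `z = y`, `π z = x`: then `π x = π (π y) = y`
      rw [← h2, ← h1]
      have := (mem_fpfInvolutions.1 hπ).1
      have hzz : π (π z) = z := by
        have h := congrArg (fun τ : Perm (Fin n) => τ z) this
        simpa [Perm.mul_apply] using h
      exact hzz.symm
  · rintro rfl
    exact ⟨x, rfl⟩

/-- The edge set of a fixed-point-free involution is a perfect matching. [cite: Rothvoss2017, §2 (PDF p. 6)] -/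
theorem isPMOn_edgesOf {π : Perm (Fin n)} (hπ : π ∈ fpfInvolutions n) :
    IsPMOn (univ : Finset (Fin n)) (edgesOf π) := by
  refine isPMOn_univ_of_existsUnique (fun e he => ?_) (fun v => ?_)
  · obtain ⟨x, rfl⟩ := mem_edgesOf.1 he
    rw [Sym2.mk_isDiag_iff]
    exact ((mem_fpfInvolutions.1 hπ).2 x).symm
  · exact ⟨π v, (mk_mem_edgesOf_iff hπ).2 rfl, fun w hw => (mk_mem_edgesOf_iff hπ).1 hw⟩

/-- `permOf (edgesOf π) = π` for a fixed-point-free involution `π`. [cite: GodsilMeagher2015, §15.4 (PDF p. 228: perfect matchings of `K_{2k}` ↔ cosets `Sym(2k)/(Sym(2) ≀ Sym(k))`)] -/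
theorem permOf_edgesOf {π : Perm (Fin n)} (hπ : π ∈ fpfInvolutions n) : permOf (edgesOf π) = π := by
  have hM := isPMOn_edgesOf hπ
  refine Equiv.ext fun x => ?_
  exact permOf_eq_of_mem hM ((mk_mem_edgesOf_iff hπ).2 rfl)

/-- `edgesOf (permOf M) = M` for a perfect matching `M`. [cite: GodsilMeagher2015, §15.4 (PDF p. 228: perfect matchings of `K_{2k}` ↔ cosets `Sym(2k)/(Sym(2) ≀ Sym(k))`)] -/
theorem edgesOf_permOf {M : Finset (Sym2 (Fin n))} (hM : IsPMOn (univ : Finset (Fin n)) M) :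
    edgesOf (permOf M) = M := by
  ext e
  constructor
  · intro he
    obtain ⟨x, rfl⟩ := mem_edgesOf.1 he
    exact mk_permOf_mem hM x
  · intro he
    have hx : e.out.1 ∈ e := Sym2.out_fst_mem e
    rw [hM.eq_mk_partner_of_mem he hx]
    exact mem_edgesOf.2 ⟨e.out.1, by rw [permOf_apply hM]⟩

/-- `permOf` is injective on perfect matchings. [cite: GodsilMeagher2015, §15.4 (PDF p. 228: perfect matchings of `K_{2k}` ↔ cosets `Sym(2k)/(Sym(2) ≀ Sym(k))`)] -/
theorem permOf_injOn : Set.InjOn (permOf (n := n)) ↑(perfectMatchings (univ : Finset (Fin n))) := by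
  intro M hM M' hM' h
  rw [mem_coe, mem_perfectMatchings] at hM hM'
  rw [← edgesOf_permOf hM, ← edgesOf_permOf hM', h]

/-- **Perfect matchings ↔ fixed-point-free involutions**: `permOf` maps `perfectMatchings univ` ONTO
`fpfInvolutions n` (inverse `edgesOf`). [cite: GodsilMeagher2015, §15.2 (perfect matching scheme)] -/
theorem image_permOf_perfectMatchings :
    (perfectMatchings (univ : Finset (Fin n))).image permOf = fpfInvolutions n := by
  ext π
  rw [mem_image]
  constructor
  · rintro ⟨M, hM, rfl⟩
    exact permOf_mem_fpfInvolutions (mem_perfectMatchings.1 hM)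
  · intro hπ
    exact ⟨edgesOf π, mem_perfectMatchings.2 (isPMOn_edgesOf hπ), permOf_edgesOf hπ⟩

/-- `|PM_n|` is the same number in both currencies. [cite: GodsilMeagher2015, §15.2 (perfect matching scheme)] -/
theorem card_perfectMatchings_eq :
    (perfectMatchings (univ : Finset (Fin n))).card = (fpfInvolutions n).card := by
  rw [← image_permOf_perfectMatchings, card_image_of_injOn permOf_injOn]

/-- A family of perfect matchings maps into `fpfInvolutions n`. [cite: GodsilMeagher2015, §15.4 (PDF p. 228: perfect matchings of `K_{2k}` ↔ cosets `Sym(2k)/(Sym(2) ≀ Sym(k))`)] -/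
theorem image_permOf_subset {ℱ : Finset (Finset (Sym2 (Fin n)))} (hℱ : ℱ ⊆ perfectMatchings univ) :
    ℱ.image permOf ⊆ fpfInvolutions n := by
  rw [← image_permOf_perfectMatchings]
  exact image_subset_image hℱ

/-- `|ℱ.image permOf| = |ℱ|` for a family of perfect matchings. [cite: GodsilMeagher2015, §15.4 (PDF p. 228: perfect matchings of `K_{2k}` ↔ cosets `Sym(2k)/(Sym(2) ≀ Sym(k))`)] -/
theorem card_image_permOf {ℱ : Finset (Finset (Sym2 (Fin n)))} (hℱ : ℱ ⊆ perfectMatchings univ) :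
    (ℱ.image permOf).card = ℱ.card :=
  card_image_of_injOn (permOf_injOn.mono (coe_subset.2 hℱ))

/-- Transport of sums along the dictionary: `Σ_{π ∈ ℱ.image permOf} f(π) = Σ_{M ∈ ℱ} f(permOf M)`. [cite: GodsilMeagher2015, §15.4 (PDF p. 228: perfect matchings of `K_{2k}` ↔ cosets `Sym(2k)/(Sym(2) ≀ Sym(k))`)] -/
theorem sum_image_permOf {ℱ : Finset (Finset (Sym2 (Fin n)))} (hℱ : ℱ ⊆ perfectMatchings univ)
    (f : Perm (Fin n) → ℝ) : ∑ π ∈ ℱ.image permOf, f π = ∑ M ∈ ℱ, f (permOf M) :=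
  sum_image fun _ hM _ hM' h => permOf_injOn (hℱ hM) (hℱ hM') h

/-- In particular `Σ_{π ∈ PM_n} f(π) = Σ_{M ∈ perfectMatchings univ} f(permOf M)`.
[cite: GodsilMeagher2015, §15.2 (perfect matching scheme)] -/
theorem sum_fpfInvolutions_eq (f : Perm (Fin n) → ℝ) :
    ∑ π ∈ fpfInvolutions n, f π = ∑ M ∈ perfectMatchings (univ : Finset (Fin n)), f (permOf M) := by
  rw [← image_permOf_perfectMatchings, sum_image_permOf (subset_refl _)]

/-! ### The subtype `PMatch n` -/

/-- The partner permutation of `M : PMatch n` (the kernel files' `M.2.partner` as a permutation).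
[cite: Rothvoss2017, §2 (PDF p. 6)] -/
def toPerm (M : PMatch n) : Perm (Fin n) := permOf M.1

/-- `toPerm M x = M.2.partner x`. [cite: Rothvoss2017, §2 (PDF p. 6)] -/
theorem toPerm_apply (M : PMatch n) (x : Fin n) : toPerm M x = M.2.partner x := permOf_apply M.2 x

/-- `toPerm M` is a fixed-point-free involution. [cite: GodsilMeagher2015, §15.4 (PDF p. 228: perfect matchings of `K_{2k}` ↔ cosets `Sym(2k)/(Sym(2) ≀ Sym(k))`)] -/
theorem toPerm_mem (M : PMatch n) : toPerm M ∈ fpfInvolutions n := permOf_mem_fpfInvolutions M.2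

/-- `toPerm` is injective. [cite: GodsilMeagher2015, §15.4 (PDF p. 228: perfect matchings of `K_{2k}` ↔ cosets `Sym(2k)/(Sym(2) ≀ Sym(k))`)] -/
theorem toPerm_injective : Function.Injective (toPerm (n := n)) := by
  intro M M' h
  exact Subtype.ext (permOf_injOn (mem_perfectMatchings.2 M.2) (mem_perfectMatchings.2 M'.2) h)

/-- `toPerm` maps `PMatch n` onto `fpfInvolutions n`. [cite: GodsilMeagher2015, §15.2 (perfect matching scheme)] -/
theorem image_toPerm_univ : (univ : Finset (PMatch n)).image toPerm = fpfInvolutions n := by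
  ext π
  rw [mem_image]
  constructor
  · rintro ⟨M, -, rfl⟩
    exact toPerm_mem M
  · intro hπ
    exact ⟨⟨edgesOf π, isPMOn_edgesOf hπ⟩, mem_univ _, permOf_edgesOf hπ⟩

/-- `|PMatch n| = |fpfInvolutions n|`. [cite: GodsilMeagher2015, §15.2 (perfect matching scheme)] -/
theorem card_pmatch_eq : Fintype.card (PMatch n) = (fpfInvolutions n).card := by
  rw [← image_toPerm_univ, card_image_of_injective _ toPerm_injective, card_univ]

/-- Transport of sums: `Σ_{π ∈ Y.image toPerm} f(π) = Σ_{M ∈ Y} f(toPerm M)`. [cite: GodsilMeagher2015, §15.4 (PDF p. 228: perfect matchings of `K_{2k}` ↔ cosets `Sym(2k)/(Sym(2) ≀ Sym(k))`)] -/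
theorem sum_image_toPerm (Y : Finset (PMatch n)) (f : Perm (Fin n) → ℝ) :
    ∑ π ∈ Y.image toPerm, f π = ∑ M ∈ Y, f (toPerm M) :=
  sum_image fun _ _ _ _ h => toPerm_injective h

/-- `Σ_{π ∈ PM_n} f(π) = Σ_{M : PMatch n} f(toPerm M)`. [cite: GodsilMeagher2015, §15.2 (perfect matching scheme)] -/
theorem sum_fpfInvolutions_eq_sum_pmatch (f : Perm (Fin n) → ℝ) :
    ∑ π ∈ fpfInvolutions n, f π = ∑ M : PMatch n, f (toPerm M) := by
  rw [← image_toPerm_univ, sum_image_toPerm]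

/-- The family of edge sets of `Y : Finset (PMatch n)` is a family of perfect matchings with the same image
under `permOf`. [cite: Rothvoss2017, §2 (PDF p. 6: `𝓜_all`, perfect matchings as edge sets)] -/
theorem image_val_subset (Y : Finset (PMatch n)) :
    Y.image Subtype.val ⊆ perfectMatchings (univ : Finset (Fin n)) := by
  intro M hM
  obtain ⟨M', -, rfl⟩ := mem_image.1 hM
  exact mem_perfectMatchings.2 M'.2

/-- `(Y.image val).image permOf = Y.image toPerm`. [cite: GodsilMeagher2015, §15.4 (PDF p. 228: perfect matchings of `K_{2k}` ↔ cosets `Sym(2k)/(Sym(2) ≀ Sym(k))`)] -/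
theorem image_permOf_image_val (Y : Finset (PMatch n)) : (Y.image Subtype.val).image permOf = Y.image toPerm := by
  rw [image_image]
  rfl

/-- `|Y.image val| = |Y|`. [cite: Rothvoss2017, §2 (PDF p. 6: `𝓜_all`, perfect matchings as edge sets)] -/
theorem card_image_val (Y : Finset (PMatch n)) : (Y.image Subtype.val).card = Y.card :=
  card_image_of_injective _ Subtype.val_injective

/-! ## §2 Partial matchings: partner form `(D, φ)` ↔ edge sets; stars -/

/-- The edge set `{{x, φ x} : x ∈ D}` of a partial matching given in partner form (`φ` a fixed-point-free
involution of the vertex set `D`). [cite: KupavskiiZakharov2022, §2 (families of sets; here sets of edges)] -/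
def pmEdges (D : Finset (Fin n)) (φ : Fin n → Fin n) : Finset (Sym2 (Fin n)) := D.image fun x => s(x, φ x)

/-- A partial matching on `D` has `|D|/2` edges: `2 · |pmEdges D φ| = |D|` (each edge `{x, φ x}` arises from
exactly the two vertices `x, φ x ∈ D`). [cite: GodsilMeagher2015, §7.4 (PDF p. 110: perfect matchings of `K_{2m}`)] -/
theorem two_mul_card_pmEdges {D : Finset (Fin n)} {φ : Fin n → Fin n} (hD1 : ∀ x ∈ D, φ x ∈ D)
    (hD2 : ∀ x ∈ D, φ (φ x) = x) (hD3 : ∀ x ∈ D, φ x ≠ x) : 2 * (pmEdges D φ).card = D.card := by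
  classical
  rw [pmEdges, card_eq_sum_card_image (fun x => s(x, φ x)) D]
  -- the fibre of `{x, φ x}` is `{x, φ x}`
  have hfib : ∀ e ∈ D.image (fun x => s(x, φ x)), (D.filter (fun y => s(y, φ y) = e)).card = 2 := by
    intro e he
    obtain ⟨x, hx, rfl⟩ := mem_image.1 he
    have hset : D.filter (fun y => s(y, φ y) = s(x, φ x)) = {x, φ x} := by
      ext y
      simp only [mem_filter, mem_insert, mem_singleton]
      constructor
      · rintro ⟨-, h⟩
        rcases Sym2.eq_iff.1 h with ⟨h1, -⟩ | ⟨h1, -⟩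
        · exact Or.inl h1
        · exact Or.inr h1
      · rintro (rfl | rfl)
        · exact ⟨hx, rfl⟩
        · exact ⟨hD1 x hx, by rw [hD2 x hx, Sym2.eq_swap]⟩
    rw [hset, card_pair (hD3 x hx).symm]
  rw [sum_congr rfl hfib, sum_const, smul_eq_mul, mul_comm]

/-- **Stars = pin conditions**: a perfect matching `M` contains the partial matching `(D, φ)` (as edges) iff its
partner map agrees with `φ` on `D`. [cite: KupavskiiZakharov2022, §2 (the star 𝒜(S))] -/
theorem pmEdges_subset_iff {M : Finset (Sym2 (Fin n))} (hM : IsPMOn (univ : Finset (Fin n)) M)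
    (D : Finset (Fin n)) (φ : Fin n → Fin n) : pmEdges D φ ⊆ M ↔ ∀ x ∈ D, permOf M x = φ x := by
  constructor
  · intro h x hx
    exact permOf_eq_of_mem hM (h (mem_image_of_mem _ hx))
  · intro h e he
    obtain ⟨x, hx, rfl⟩ := mem_image.1 he
    rw [← h x hx]
    exact mk_permOf_mem hM x

/-- The star of `(D, φ)` in a family of perfect matchings, transported: the members of `ℱ.image permOf` that
agree with `φ` on `D` are the images of the members of `ℱ` containing `pmEdges D φ`.
[cite: KupavskiiZakharov2022, §2 (the star ℱ(S))] -/
theorem filter_image_permOf_eq {ℱ : Finset (Finset (Sym2 (Fin n)))} (hℱ : ℱ ⊆ perfectMatchings univ)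
    (D : Finset (Fin n)) (φ : Fin n → Fin n) :
    (ℱ.image permOf).filter (fun π : Perm (Fin n) => ∀ x ∈ D, π x = φ x) =
      (supersets ℱ (pmEdges D φ)).image permOf := by
  ext π
  simp only [mem_filter, mem_image, mem_supersets]
  constructor
  · rintro ⟨⟨M, hM, rfl⟩, hπ⟩
    exact ⟨M, ⟨hM, (pmEdges_subset_iff (mem_perfectMatchings.1 (hℱ hM)) D φ).2 hπ⟩, rfl⟩
  · rintro ⟨M, ⟨hM, hS⟩, rfl⟩
    exact ⟨⟨M, hM, rfl⟩, (pmEdges_subset_iff (mem_perfectMatchings.1 (hℱ hM)) D φ).1 hS⟩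

/-- Cardinality form: `|{π ∈ ℱ.image permOf : π|_D = φ}| = |ℱ(pmEdges D φ)|`. [cite: KupavskiiZakharov2022, §2] -/
theorem card_filter_image_permOf {ℱ : Finset (Finset (Sym2 (Fin n)))} (hℱ : ℱ ⊆ perfectMatchings univ)
    (D : Finset (Fin n)) (φ : Fin n → Fin n) :
    ((ℱ.image permOf).filter (fun π : Perm (Fin n) => ∀ x ∈ D, π x = φ x)).card =
      (supersets ℱ (pmEdges D φ)).card := by
  rw [filter_image_permOf_eq hℱ, card_image_permOf ((supersets_subset ℱ _).trans hℱ)]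

/-- In particular for the whole of `PM_n`: `|{π ∈ PM_n : π|_D = φ}| = |𝒜(pmEdges D φ)|`, `𝒜 = perfectMatchings univ`.
[cite: KupavskiiZakharov2022, §2] -/
theorem card_filter_fpfInvolutions (D : Finset (Fin n)) (φ : Fin n → Fin n) :
    ((fpfInvolutions n).filter (fun π : Perm (Fin n) => ∀ x ∈ D, π x = φ x)).card =
      (supersets (perfectMatchings (univ : Finset (Fin n))) (pmEdges D φ)).card := by
  rw [← image_permOf_perfectMatchings]
  exact card_filter_image_permOf (subset_refl _) D φ

/-- The vertex set covered by an edge set (the support of a partial matching). [cite: KupavskiiZakharov2022, §2 (stars `𝒜(S)`; for `𝒜` = perfect matchings only matchings `S` have nonempty stars)] -/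
def verts (S : Finset (Sym2 (Fin n))) : Finset (Fin n) := univ.filter fun v => ∃ e ∈ S, v ∈ e

/-- Membership in `verts S`. [cite: KupavskiiZakharov2022, §2 (stars `𝒜(S)`; for `𝒜` = perfect matchings only matchings `S` have nonempty stars)] -/
theorem mem_verts {S : Finset (Sym2 (Fin n))} {v : Fin n} : v ∈ verts S ↔ ∃ e ∈ S, v ∈ e := by
  simp [verts]

/-- **Every extendable edge set is a partial matching in partner form**: if `S ⊆ M` for a perfect matching `M`,
then `S = pmEdges (verts S) (permOf M)`, and `verts S` is closed under `permOf M`.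
[cite: KupavskiiZakharov2022, §2 (the star 𝒜(S))] -/
theorem pmEdges_verts_eq {S M : Finset (Sym2 (Fin n))} (hM : IsPMOn (univ : Finset (Fin n)) M) (hSM : S ⊆ M) :
    pmEdges (verts S) (permOf M) = S := by
  ext e
  constructor
  · intro he
    obtain ⟨x, hx, rfl⟩ := mem_image.1 he
    obtain ⟨e', he', hxe'⟩ := mem_verts.1 hx
    have : e' = s(x, permOf M x) := by rw [permOf_apply hM]; exact hM.eq_mk_partner_of_mem (hSM he') hxe'
    rw [← this]
    exact he'
  · intro he
    have hx : e.out.1 ∈ e := Sym2.out_fst_mem e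
    have heq : e = s(e.out.1, permOf M e.out.1) := by
      rw [permOf_apply hM]; exact hM.eq_mk_partner_of_mem (hSM he) hx
    rw [heq]
    exact mem_image_of_mem _ (mem_verts.2 ⟨e, he, hx⟩)

/-- The support of `S ⊆ M` is closed under the partner map of `M`. [cite: KupavskiiZakharov2022, §2 (stars `𝒜(S)`; for `𝒜` = perfect matchings only matchings `S` have nonempty stars)] -/
theorem permOf_mem_verts {S M : Finset (Sym2 (Fin n))} (hM : IsPMOn (univ : Finset (Fin n)) M) (hSM : S ⊆ M)
    {x : Fin n} (hx : x ∈ verts S) : permOf M x ∈ verts S := by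
  obtain ⟨e, he, hxe⟩ := mem_verts.1 hx
  have heq : e = s(x, permOf M x) := by rw [permOf_apply hM]; exact hM.eq_mk_partner_of_mem (hSM he) hxe
  exact mem_verts.2 ⟨e, he, by rw [heq]; exact Sym2.mem_mk_right _ _⟩

/-! ## §3 Kupavskii–Zakharov homogeneity in the two currencies -/

/-- **Edge-set homogeneity ⇒ partner-map homogeneity.** If a family `ℱ` of perfect matchings (edge sets) is
`(perfectMatchings univ, τ)`-homogeneous in the sense of Kupavskii–Zakharov, then `ℱ.image permOf` is a
`τ`-homogeneous family of perfect matchings in the partner-map sense of `MatchingLevelInequality`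
(`|Y ∩ ⟨F⟩|·|PM_n| ≤ τ^{|F|}·|Y|·|⟨F⟩|` for every partial matching `F`, `|F| = |D|/2` edges).
[cite: KupavskiiZakharov2022, §2 (definition of (𝒜, τ)-homogeneous)] -/
theorem isHomogeneousMatchingFamily_image_permOf {τ : ℝ} {ℱ : Finset (Finset (Sym2 (Fin n)))}
    (hℱ : ℱ ⊆ perfectMatchings univ) (h : IsRelHomogeneous τ (perfectMatchings (univ : Finset (Fin n))) ℱ) :
    IsHomogeneousMatchingFamily τ (ℱ.image permOf) := by
  intro D φ hD1 hD2 hD3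
  have hS := h (pmEdges D φ)
  rw [card_perfectMatchings_eq] at hS
  rw [card_filter_image_permOf hℱ, card_image_permOf hℱ, card_filter_fpfInvolutions,
    ← two_mul_card_pmEdges hD1 hD2 hD3, Nat.mul_div_cancel_left _ (by norm_num : 0 < 2)]
  calc ((supersets ℱ (pmEdges D φ)).card : ℝ) * (fpfInvolutions n).card
      ≤ τ ^ (pmEdges D φ).card * (supersets (perfectMatchings univ) (pmEdges D φ)).card * ℱ.card := hS
    _ = τ ^ (pmEdges D φ).card * ℱ.card * (supersets (perfectMatchings univ) (pmEdges D φ)).card := by ring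

/-- **Partner-map homogeneity ⇒ edge-set homogeneity** (`τ ≥ 0`): the converse. An edge set `S` contained in no
member of `ℱ` contributes `0 ≤ 0`; otherwise `S` is a partial matching `(verts S, permOf M)` and the partner-map
condition is the edge-set condition verbatim. [cite: KupavskiiZakharov2022, §2 (definition of (𝒜, τ)-homogeneous)] -/
theorem isRelHomogeneous_of_image_permOf {τ : ℝ} (hτ : 0 ≤ τ) {ℱ : Finset (Finset (Sym2 (Fin n)))}
    (hℱ : ℱ ⊆ perfectMatchings univ) (h : IsHomogeneousMatchingFamily τ (ℱ.image permOf)) :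
    IsRelHomogeneous τ (perfectMatchings (univ : Finset (Fin n))) ℱ := by
  intro S
  by_cases hne : (supersets ℱ S).Nonempty
  · obtain ⟨M, hM⟩ := hne
    obtain ⟨hMℱ, hSM⟩ := mem_supersets.1 hM
    have hMpm : IsPMOn univ M := mem_perfectMatchings.1 (hℱ hMℱ)
    set D := verts S with hD
    set φ : Fin n → Fin n := ⇑(permOf M) with hφ
    have hD1 : ∀ x ∈ D, φ x ∈ D := fun x hx => permOf_mem_verts hMpm hSM hx
    have hD2 : ∀ x ∈ D, φ (φ x) = x := fun x _ => permOf_permOf hMpm x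
    have hD3 : ∀ x ∈ D, φ x ≠ x := fun x _ => permOf_ne hMpm x
    have hSeq : pmEdges D φ = S := pmEdges_verts_eq hMpm hSM
    have key := h D φ hD1 hD2 hD3
    rw [card_filter_image_permOf hℱ, card_image_permOf hℱ, card_filter_fpfInvolutions,
      ← two_mul_card_pmEdges hD1 hD2 hD3, Nat.mul_div_cancel_left _ (by norm_num : 0 < 2), hSeq] at key
    rw [card_perfectMatchings_eq]
    calc ((supersets ℱ S).card : ℝ) * (fpfInvolutions n).card
        ≤ τ ^ S.card * ℱ.card * (supersets (perfectMatchings univ) S).card := key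
      _ = τ ^ S.card * (supersets (perfectMatchings univ) S).card * ℱ.card := by ring
  · rw [not_nonempty_iff_eq_empty.1 hne, card_empty, Nat.cast_zero, zero_mul]
    positivity

/-- **The two homogeneity notions coincide** (`τ ≥ 0`). [cite: KupavskiiZakharov2022, §2] -/
theorem isRelHomogeneous_iff_isHomogeneousMatchingFamily {τ : ℝ} (hτ : 0 ≤ τ)
    {ℱ : Finset (Finset (Sym2 (Fin n)))} (hℱ : ℱ ⊆ perfectMatchings univ) :
    IsRelHomogeneous τ (perfectMatchings (univ : Finset (Fin n))) ℱ ↔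
      IsHomogeneousMatchingFamily τ (ℱ.image permOf) :=
  ⟨isHomogeneousMatchingFamily_image_permOf hℱ, isRelHomogeneous_of_image_permOf hτ hℱ⟩

/-! ## §4 The matching-side level-`k` inequality in edge-set and `PMatch` currency -/

/-- **(F2) IN KUPAVSKII–ZAKHAROV'S CURRENCY (modulo Keevash–Lifshitz Thm 1.8).** For a family `ℱ` of perfect
matchings of `K_n` (edge sets) that is `(perfectMatchings univ, τ)`-homogeneous with `τ ≥ 1`, `ν = |ℱ|/|PM_n|`,
and a harmonic coefficient vector `p` of degree `k` with `1 ≤ k ≤ min(⅛ log(1/ν), 10⁻⁵ n)`: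
`(Σ_{M ∈ ℱ} Π_p(M))² ≤ ν² · (C τ² k⁻¹ log(1/ν))^k · |PM_n| · Σ_{M ∈ PM_n} Π_p(M)²`, where
`Π_p(M) = closedSum k p (permOf M) = Σ_{T M-closed, |T| = k} p_T` and `C` is the absolute constant of
Theorem 1.8. This is `MatchingLevelInequality.closedSum_sq_le_of_homogeneous` transported along §1–§3; the
reference matching of that statement is eliminated (any member of `ℱ`; for `ℱ = ∅` both sides vanish).
[cite: KeevashLifshitz2023, Thm. 1.8] -/
theorem closedSum_sq_le_of_relHomogeneous (h : GlobalLevelDInequality) :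
    ∃ C : ℝ, 0 < C ∧ ∀ (n : ℕ) (ℱ : Finset (Finset (Sym2 (Fin n)))),
      ℱ ⊆ perfectMatchings (univ : Finset (Fin n)) →
      ∀ (τ : ℝ) (k : ℕ) (p : Finset (Fin n) → ℝ), 1 ≤ τ →
      IsRelHomogeneous τ (perfectMatchings (univ : Finset (Fin n))) ℱ →
      1 ≤ k → IsHarmonic k p →
      (k : ℝ) ≤ Real.log (1 / ((ℱ.card : ℝ) / (perfectMatchings (univ : Finset (Fin n))).card)) / 8 →
      (k : ℝ) ≤ (n : ℝ) / 10 ^ 5 →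
      (∑ M ∈ ℱ, closedSum k p (permOf M)) ^ 2 ≤
        ((ℱ.card : ℝ) / (perfectMatchings (univ : Finset (Fin n))).card) ^ 2 *
          (C * τ ^ 2 * (1 / (k : ℝ)) *
              Real.log (1 / ((ℱ.card : ℝ) / (perfectMatchings (univ : Finset (Fin n))).card))) ^ k *
          ((perfectMatchings (univ : Finset (Fin n))).card *
            ∑ M ∈ perfectMatchings (univ : Finset (Fin n)), closedSum k p (permOf M) ^ 2) := by
  obtain ⟨C, hC, hmain⟩ := closedSum_sq_le_of_homogeneous h
  refine ⟨C, hC, fun n ℱ hℱ τ k p hτ hhom hk hp h8 hn => ?_⟩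
  rcases ℱ.eq_empty_or_nonempty with hℱe | ⟨M₀, hM₀⟩
  · -- empty family: both sides vanish
    rw [hℱe, sum_empty, card_empty, Nat.cast_zero, zero_div]
    have : ((0 : ℝ)) ^ 2 = 0 := by norm_num
    rw [this, zero_mul, zero_mul]
  · have hs : permOf M₀ ∈ fpfInvolutions n := permOf_mem_fpfInvolutions (mem_perfectMatchings.1 (hℱ hM₀))
    have hY : ℱ.image permOf ⊆ fpfInvolutions n := image_permOf_subset hℱ
    have hYh : IsHomogeneousMatchingFamily τ (ℱ.image permOf) := isHomogeneousMatchingFamily_image_permOf hℱ hhom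
    have key := hmain n (permOf M₀) hs (ℱ.image permOf) hY τ k p hτ hYh hk hp
    rw [card_image_permOf hℱ, ← card_perfectMatchings_eq, sum_image_permOf hℱ, sum_fpfInvolutions_eq] at key
    exact key h8 hn

/-- **(F2) IN THE KERNEL'S CURRENCY (modulo Keevash–Lifshitz Thm 1.8).** For `Y : Finset (PMatch n)` whose
family of edge sets is `(perfectMatchings univ, τ)`-homogeneous (`τ ≥ 1`), `ν = |Y|/|PMatch n|`, and a harmonic
`p` of degree `k` with `1 ≤ k ≤ min(⅛ log(1/ν), 10⁻⁵ n)`, the matching-side sums of the bi-mode expansion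
(`…ChebyshevTracialDesignRectangleBiMode.card_filter_level_eq_bimode`, functional
`Σ_{T : #{x ∈ T : M.partner x ∈ T} = k} p_T`) satisfy
`(Σ_{M ∈ Y} Σ_{T : #{x∈T : M.partner x ∈ T} = k} p_T)² ≤ ν²·(C τ² k⁻¹ log(1/ν))^k·|PMatch n|·Σ_{M : PMatch n} (Σ_T …)²`.
[cite: KeevashLifshitz2023, Thm. 1.8] -/
theorem pmatch_closedSum_sq_le (h : GlobalLevelDInequality) :
    ∃ C : ℝ, 0 < C ∧ ∀ (n : ℕ) (Y : Finset (PMatch n)) (τ : ℝ) (k : ℕ) (p : Finset (Fin n) → ℝ), 1 ≤ τ →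
      IsRelHomogeneous τ (perfectMatchings (univ : Finset (Fin n))) (Y.image Subtype.val) →
      1 ≤ k → IsHarmonic k p →
      (k : ℝ) ≤ Real.log (1 / ((Y.card : ℝ) / Fintype.card (PMatch n))) / 8 →
      (k : ℝ) ≤ (n : ℝ) / 10 ^ 5 →
      (∑ M ∈ Y, ∑ T ∈ univ.filter (fun T : Finset (Fin n) => (T.filter fun x => M.2.partner x ∈ T).card = k), p T) ^ 2 ≤
        ((Y.card : ℝ) / Fintype.card (PMatch n)) ^ 2 *
          (C * τ ^ 2 * (1 / (k : ℝ)) * Real.log (1 / ((Y.card : ℝ) / Fintype.card (PMatch n)))) ^ k *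
          ((Fintype.card (PMatch n) : ℝ) *
            ∑ M : PMatch n,
              (∑ T ∈ univ.filter (fun T : Finset (Fin n) => (T.filter fun x => M.2.partner x ∈ T).card = k), p T) ^ 2) := by
  obtain ⟨C, hC, hmain⟩ := closedSum_sq_le_of_homogeneous h
  refine ⟨C, hC, fun n Y τ k p hτ hhom hk hp h8 hn => ?_⟩
  -- rewrite the kernel's functional as `closedSum k p (toPerm M)`
  have hfun : ∀ M : PMatch n,
      ∑ T ∈ univ.filter (fun T : Finset (Fin n) => (T.filter fun x => M.2.partner x ∈ T).card = k), p T =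
        closedSum k p (toPerm M) := by
    intro M
    rw [← closedSum_eq_sum_filter_card hp.1 (toPerm M)]
    refine sum_congr ?_ fun _ _ => rfl
    ext T
    simp only [mem_filter, mem_univ, true_and, toPerm_apply]
  simp_rw [hfun]
  rcases Y.eq_empty_or_nonempty with hYe | ⟨M₀, hM₀⟩
  · rw [hYe, sum_empty, card_empty, Nat.cast_zero, zero_div]
    have : ((0 : ℝ)) ^ 2 = 0 := by norm_num
    rw [this, zero_mul, zero_mul]
  · have hs : toPerm M₀ ∈ fpfInvolutions n := toPerm_mem M₀
    have hY : Y.image toPerm ⊆ fpfInvolutions n := by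
      intro π hπ
      obtain ⟨M, -, rfl⟩ := mem_image.1 hπ
      exact toPerm_mem M
    have hYh : IsHomogeneousMatchingFamily τ (Y.image toPerm) := by
      rw [← image_permOf_image_val]
      exact isHomogeneousMatchingFamily_image_permOf (image_val_subset Y) hhom
    have key := hmain n (toPerm M₀) hs (Y.image toPerm) hY τ k p hτ hYh hk hp
    rw [card_image_of_injective _ toPerm_injective, ← card_pmatch_eq, sum_image_toPerm,
      sum_fpfInvolutions_eq_sum_pmatch] at key
    exact key h8 hn

/-! ## §5 The matching-side norm `Σ_{π ∈ PM_n} Π_p(π)²` through the Johnson spectrum -/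

/-- Conjugates of fixed-point-free involutions are fixed-point-free involutions. [folklore] -/
private theorem conj_mem_fpfInvolutions' {π : Perm (Fin n)} (hπ : π ∈ fpfInvolutions n) (σ : Perm (Fin n)) :
    σ * π * σ⁻¹ ∈ fpfInvolutions n := by
  rw [mem_fpfInvolutions] at hπ ⊢
  refine ⟨?_, fun x hx => ?_⟩
  · rw [show σ * π * σ⁻¹ * (σ * π * σ⁻¹) = σ * (π * π) * σ⁻¹ by group, hπ.1]; group
  · have : π (σ⁻¹ x) = σ⁻¹ x := by
      have h := congrArg (⇑σ⁻¹) hx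
      simpa [Perm.mul_apply] using h
    exact hπ.2 _ this

/-- **The closed-pair count**: the number of perfect matchings of `K_n` (fixed-point-free involutions) for which
both vertex sets `T` and `T'` are closed (unions of edges). [cite: GodsilMeagher2015, §15.2 (perfect matching scheme)] -/
def closedPairCount (T T' : Finset (Fin n)) : ℕ :=
  ((fpfInvolutions n).filter (fun π : Perm (Fin n) => (∀ x ∈ T, π x ∈ T) ∧ ∀ x ∈ T', π x ∈ T')).card

/-- A set is closed under `σ π σ⁻¹` iff its `σ⁻¹`-image is closed under `π`; in image form: `σ(S)` is
`σ π σ⁻¹`-closed iff `S` is `π`-closed. [folklore] -/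
private theorem forall_image_conj_iff (σ π : Perm (Fin n)) (S : Finset (Fin n)) :
    (∀ y ∈ S.image σ, (σ * π * σ⁻¹) y ∈ S.image σ) ↔ ∀ x ∈ S, π x ∈ S := by
  constructor
  · intro h x hx
    have := h (σ x) (mem_image_of_mem _ hx)
    rw [show (σ * π * σ⁻¹) (σ x) = σ (π x) by simp [Perm.mul_apply]] at this
    obtain ⟨x', hx', hxx'⟩ := mem_image.1 this
    rw [← σ.injective hxx']
    exact hx'
  · intro h y hy
    obtain ⟨x, hx, rfl⟩ := mem_image.1 hy
    rw [show (σ * π * σ⁻¹) (σ x) = σ (π x) by simp [Perm.mul_apply]]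
    exact mem_image_of_mem _ (h x hx)

/-- **Conjugation invariance**: `closedPairCount (σ T) (σ T') = closedPairCount T T'` (relabel the matchings by `σ`).
[cite: GodsilMeagher2015, §15.2 (perfect matching scheme: `S_n` acts on perfect matchings)] -/
theorem closedPairCount_image (σ : Perm (Fin n)) (T T' : Finset (Fin n)) :
    closedPairCount (T.image σ) (T'.image σ) = closedPairCount T T' := by
  unfold closedPairCount
  symm
  refine card_nbij' (fun π => σ * π * σ⁻¹) (fun π' => σ⁻¹ * π' * σ) ?_ ?_ ?_ ?_
  · intro π hπ
    rw [mem_coe, mem_filter] at hπ ⊢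
    exact ⟨conj_mem_fpfInvolutions' hπ.1 σ, (forall_image_conj_iff σ π T).2 hπ.2.1,
      (forall_image_conj_iff σ π T').2 hπ.2.2⟩
  · intro π' hπ'
    rw [mem_coe, mem_filter] at hπ' ⊢
    have h1 : σ * (σ⁻¹ * π' * σ) * σ⁻¹ = π' := by group
    refine ⟨?_, ?_, ?_⟩
    · have := conj_mem_fpfInvolutions' hπ'.1 σ⁻¹
      rwa [inv_inv] at this
    · rw [← forall_image_conj_iff σ (σ⁻¹ * π' * σ) T, h1]; exact hπ'.2.1
    · rw [← forall_image_conj_iff σ (σ⁻¹ * π' * σ) T', h1]; exact hπ'.2.2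
  · intro π _; group
  · intro π' _; group

/-- A permutation fixing the complement of `R` pointwise maps `R` onto itself. [folklore] -/
private theorem image_eq_self_of_fix_compl {R : Finset (Fin n)} {ρ : Perm (Fin n)} (hρ : ∀ x ∈ Rᶜ, ρ x = x) :
    R.image ρ = R := by
  apply eq_of_subset_of_card_le
  · intro y hy
    obtain ⟨x, hx, rfl⟩ := mem_image.1 hy
    by_contra hout
    have h1 : ρ (ρ x) = ρ x := hρ _ (mem_compl.2 hout)
    have h2 : ρ x = x := ρ.injective h1
    exact hout (by rw [h2]; exact hx)
  · rw [card_image_of_injective _ ρ.injective]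

/-- A permutation fixing `R` pointwise maps `R` onto itself. [folklore] -/
private theorem image_eq_self_of_fix {R : Finset (Fin n)} {ρ : Perm (Fin n)} (hρ : ∀ x ∈ R, ρ x = x) :
    R.image ρ = R := by
  rw [image_congr (fun x hx => hρ x hx)]
  exact image_id

/-- **`S_n` is transitive on pairs of sets with prescribed sizes and intersection size**: if `|T₁| = |T₂|`,
`|T₁'| = |T₂'|` and `|T₁ ∩ T₁'| = |T₂ ∩ T₂'|`, some permutation maps `T₁ ↦ T₂` and `T₁' ↦ T₂'` simultaneously
(the orbits of `S_n` on pairs of `k`-sets are the classes of the Johnson scheme).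
[cite: GodsilMeagher2015, §13.5 (PDF p. 199: the orbitals of `Sym(n)` on `k`-sets are the pairs with intersection size exactly `i`)] -/
theorem exists_perm_image_pair_eq {T₁ T₁' T₂ T₂' : Finset (Fin n)} (h1 : T₁.card = T₂.card)
    (h2 : T₁'.card = T₂'.card) (h3 : (T₁ ∩ T₁').card = (T₂ ∩ T₂').card) :
    ∃ σ : Perm (Fin n), T₁.image σ = T₂ ∧ T₁'.image σ = T₂' := by
  classical
  -- step 1: move `T₁` onto `T₂`
  obtain ⟨σ₁, -, hσ₁⟩ := exists_perm_fixing_image_eq (T₁ \ T₂).card ∅ T₁ T₂ rfl h1 (by simp)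
  set A := T₁'.image σ₁ with hA
  have hAcard : A.card = T₂'.card := by rw [hA, card_image_of_injective _ σ₁.injective, h2]
  have hAT₂ : (A ∩ T₂).card = (T₂' ∩ T₂).card := by
    have : A ∩ T₂ = (T₁' ∩ T₁).image σ₁ := by rw [image_inter _ _ σ₁.injective, hσ₁]
    rw [this, card_image_of_injective _ σ₁.injective, inter_comm, h3, inter_comm]
  -- step 2: inside `T₂`, move `A ∩ T₂` onto `T₂' ∩ T₂` by a permutation fixing `T₂ᶜ` pointwise
  obtain ⟨ρ₀, hρ₀fix, hρ₀⟩ := exists_perm_fixing_image_eq ((A ∩ T₂) \ (T₂' ∩ T₂)).card T₂ᶜ (A ∩ T₂)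
    (T₂' ∩ T₂) rfl hAT₂ (by
      ext x; simp only [mem_inter, mem_compl]; tauto)
  have hρ₀T₂ : T₂.image ρ₀ = T₂ := image_eq_self_of_fix_compl hρ₀fix
  set B := A.image ρ₀ with hB
  have hBcard : B.card = T₂'.card := by rw [hB, card_image_of_injective _ ρ₀.injective, hAcard]
  have hBT₂ : B ∩ T₂ = T₂' ∩ T₂ := by
    rw [hB, ← hρ₀]
    conv_lhs => rw [← hρ₀T₂]
    rw [← image_inter _ _ ρ₀.injective]
  -- step 3: fixing `T₂` pointwise, move `B` onto `T₂'`
  obtain ⟨ρ₁, hρ₁fix, hρ₁⟩ := exists_perm_fixing_image_eq (B \ T₂').card T₂ B T₂' rfl hBcard hBT₂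
  have hρ₁T₂ : T₂.image ρ₁ = T₂ := image_eq_self_of_fix hρ₁fix
  refine ⟨ρ₁ * ρ₀ * σ₁, ?_, ?_⟩
  · rw [show (⇑(ρ₁ * ρ₀ * σ₁) : Fin n → Fin n) = ρ₁ ∘ ρ₀ ∘ σ₁ from rfl, ← image_image, ← image_image, hσ₁,
      hρ₀T₂, hρ₁T₂]
  · rw [show (⇑(ρ₁ * ρ₀ * σ₁) : Fin n → Fin n) = ρ₁ ∘ ρ₀ ∘ σ₁ from rfl, ← image_image, ← image_image, ← hA,
      ← hB, hρ₁]

/-- **The closed-pair count is a class function of the Johnson scheme**: for `k`-sets it depends only on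
`|T ∩ T'|`. [cite: GodsilMeagher2015, §15.2 (perfect matching scheme)] -/
theorem closedPairCount_eq_of_card_inter_eq {T₁ T₁' T₂ T₂' : Finset (Fin n)} (h1 : T₁.card = T₂.card)
    (h2 : T₁'.card = T₂'.card) (h3 : (T₁ ∩ T₁').card = (T₂ ∩ T₂').card) :
    closedPairCount T₁ T₁' = closedPairCount T₂ T₂' := by
  obtain ⟨σ, hσ, hσ'⟩ := exists_perm_image_pair_eq h1 h2 h3
  rw [← hσ, ← hσ', closedPairCount_image]

/-- **The closed-pair profile** `κ_{n,k}(i)` = the closed-pair count of any two `k`-sets meeting in `i` points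
(`0` if there are none). Explicitly `κ(i) = pm(i)·pm(k−i)²·pm(n−2k+i)` with `pm(m)` = number of perfect matchings
of `m` points (kernel file `…ChebyshevTracialDesignClosedPairCount.card_filter_closed_closed`); only the class-function
property is used here. [cite: GodsilMeagher2015, §15.2 (perfect matching scheme)] -/
def closedPairProfile (n k i : ℕ) : ℝ := by
  classical
  exact if h : ∃ P : Finset (Fin n) × Finset (Fin n), P.1.card = k ∧ P.2.card = k ∧ (P.1 ∩ P.2).card = i
    then (closedPairCount h.choose.1 h.choose.2 : ℝ) else 0

/-- `closedPairCount T T' = κ_{n,k}(|T ∩ T'|)` for `k`-sets `T, T'`. [cite: GodsilMeagher2015, §15.2 (perfect matching scheme)] -/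
theorem closedPairCount_eq_profile {k : ℕ} {T T' : Finset (Fin n)} (hT : T.card = k) (hT' : T'.card = k) :
    (closedPairCount T T' : ℝ) = closedPairProfile n k (T ∩ T').card := by
  classical
  have h : ∃ P : Finset (Fin n) × Finset (Fin n), P.1.card = k ∧ P.2.card = k ∧ (P.1 ∩ P.2).card = (T ∩ T').card :=
    ⟨(T, T'), hT, hT', rfl⟩
  unfold closedPairProfile
  rw [dif_pos h]
  obtain ⟨h1, h2, h3⟩ := h.choose_spec
  exact_mod_cast closedPairCount_eq_of_card_inter_eq (hT.trans h1.symm) (hT'.trans h2.symm) h3.symm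

/-- **THE MATCHING-SIDE NORM THROUGH THE JOHNSON SPECTRUM.** For a harmonic coefficient vector `p` of degree `k`
(`JohnsonHarmonics.IsHarmonic k p`): `Σ_{π ∈ PM_n} Π_p(π)² = kernelEigen n k k κ_{n,k} · ⟪p, p⟫` — the Gram kernel
`Σ_π [T π-closed][T' π-closed] = κ_{n,k}(|T ∩ T'|)` of the closed-set incidence lies in the Bose–Mesner algebra of
`J(n,k)` and `p` spans the top eigenspace, so `JohnsonSpectrum.sum_sq_gram_ladder` applies with `t = j = k`. This is
the normalising factor of (F2)'s right-hand side `|PM_n| · Σ_π Π_p(π)²`.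
[cite: MacWilliamsSloane1977, Ch. 21 §6 Thm. 10 with Problem (11) (PDF p. 516)]
[cite: GodsilMeagher2015, §15.2 (perfect matching scheme)] -/
theorem sum_closedSum_sq_eq {k : ℕ} {p : Finset (Fin n) → ℝ} (hp : IsHarmonic k p) :
    ∑ π ∈ fpfInvolutions n, closedSum k p π ^ 2 = kernelEigen n k k (closedPairProfile n k) * ip p p := by
  classical
  -- the closed-set incidence `A(T, π) = [T is π-closed]` on `β = fpfInvolutions n`
  set A : Finset (Fin n) → (fpfInvolutions n) → ℝ :=
    fun T π => if ∀ x ∈ T, (π : Perm (Fin n)) x ∈ T then 1 else 0 with hAdef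
  have hA : ∀ U ∈ univ.powersetCard k, ∀ U' ∈ univ.powersetCard k,
      ∑ b, A U b * A U' b = closedPairProfile n k (U ∩ U').card := by
    intro U hU U' hU'
    rw [← closedPairCount_eq_profile (mem_powersetCard.1 hU).2 (mem_powersetCard.1 hU').2, closedPairCount,
      card_filter, Nat.cast_sum, ← sum_coe_sort (fpfInvolutions n)]
    refine sum_congr rfl fun π _ => ?_
    simp only [hAdef]
    split_ifs <;> simp_all
  have key := sum_sq_gram_ladder (le_refl k) A (closedPairProfile n k) hA hp
  rw [Nat.sub_self, Function.iterate_zero, id_eq] at key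
  rw [← key, ← sum_coe_sort (fpfInvolutions n)]
  refine sum_congr rfl fun π _ => ?_
  congr 1
  rw [closedSum, closedSets, sum_filter]
  refine sum_congr rfl fun U _ => ?_
  simp only [hAdef]
  split_ifs <;> simp

/-- **Top-layer eigenvalue = `k`-th forward difference**: on the harmonic layer of degree `t` of `J(n,t)` every
kernel `κ(|U ∩ U'|)` acts as `Σ_{i ≤ t} (−1)^{t−i} C(t,i) κ(i)` (only `a = t` survives in `kernelEigen n t t κ`,
with `binomEigen n t t t = 1`). [cite: MacWilliamsSloane1977, Ch. 21 §6 Thm. 10 (PDF p. 516)] -/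
theorem kernelEigen_top (t : ℕ) (κ : ℕ → ℝ) :
    kernelEigen n t t κ = ∑ i ∈ range (t + 1), (-1 : ℝ) ^ (t - i) * (t.choose i : ℝ) * κ i := by
  unfold kernelEigen
  rw [sum_range_succ, sum_eq_zero (fun a ha => ?_), zero_add]
  · have hb : binomEigen n t t t = 1 := by
      rw [binomEigen, if_pos le_rfl, Nat.sub_self, ladderProd_zero, Nat.factorial_zero]
      norm_num
    rw [hb, mul_one, fwdDiff_iter_eq_sum_shift]
    refine sum_congr rfl fun i _ => ?_
    rw [zsmul_eq_mul, zero_add, smul_eq_mul, mul_one]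
    push_cast
    ring
  · have hat : a < t := mem_range.1 ha
    rw [binomEigen, if_neg (by omega), mul_zero]

/-- Hence, for harmonic `p` of degree `k`:
`Σ_{π ∈ PM_n} Π_p(π)² = (Σ_{i ≤ k} (−1)^{k−i} C(k,i) κ_{n,k}(i)) · ⟪p, p⟫`.
[cite: GodsilMeagher2015, §15.2 (perfect matching scheme)] -/
theorem sum_closedSum_sq_eq_alternating {k : ℕ} {p : Finset (Fin n) → ℝ} (hp : IsHarmonic k p) :
    ∑ π ∈ fpfInvolutions n, closedSum k p π ^ 2 =
      (∑ i ∈ range (k + 1), (-1 : ℝ) ^ (k - i) * (k.choose i : ℝ) * closedPairProfile n k i) * ip p p := by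
  rw [sum_closedSum_sq_eq hp, kernelEigen_top]

/-- The same norm in `PMatch` currency: `Σ_{M : PMatch n} (Σ_{T : #{x∈T : M.partner x∈T} = k} p_T)²
= kernelEigen n k k κ_{n,k} · ⟪p, p⟫`. [cite: GodsilMeagher2015, §15.2 (perfect matching scheme)] -/
theorem sum_pmatch_closedSum_sq_eq {k : ℕ} {p : Finset (Fin n) → ℝ} (hp : IsHarmonic k p) :
    ∑ M : PMatch n,
        (∑ T ∈ univ.filter (fun T : Finset (Fin n) => (T.filter fun x => M.2.partner x ∈ T).card = k), p T) ^ 2 =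
      kernelEigen n k k (closedPairProfile n k) * ip p p := by
  rw [← sum_closedSum_sq_eq hp, sum_fpfInvolutions_eq_sum_pmatch]
  refine sum_congr rfl fun M _ => ?_
  congr 1
  rw [← closedSum_eq_sum_filter_card hp.1 (toPerm M)]
  refine sum_congr ?_ fun _ _ => rfl
  ext T
  simp only [mem_filter, mem_univ, true_and, toPerm_apply]

/-! ## §6 Links of matching families: the star of a partial matching = the perfect matchings of the remaining
vertices (the reduced instance of S2), with homogeneity and relabelling -/

section MatchingLinks

variable {α : Type*} [DecidableEq α]

/-- **The link of the perfect matchings at a partial matching is the set of perfect matchings of the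
remaining vertices**: for a perfect matching `S` of `D ⊆ V`, `{M ∖ S : M ∈ PM(V), S ⊆ M} = PM(V ∖ D)`.
[cite: KupavskiiZakharov2022, §2 (p. 6, the link 𝒜(S)); Rothvoss2017, §2 (perfect matchings as edge sets)] -/
theorem link_perfectMatchings_eq {V D : Finset α} {S : Finset (Sym2 α)} (hS : IsPMOn D S) (hDV : D ⊆ V) :
    link (perfectMatchings V) S = perfectMatchings (V \ D) := by
  have hd : Disjoint D (V \ D) := disjoint_sdiff
  have hV : D ∪ (V \ D) = V := union_sdiff_of_subset hDV
  ext B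
  rw [mem_link, mem_perfectMatchings]
  constructor
  · rintro ⟨M, hM, hSM, rfl⟩
    have hM' : IsPMOn (D ∪ (V \ D)) M := by rw [hV]; exact mem_perfectMatchings.1 hM
    exact hM'.sdiff hd hS hSM
  · intro hB
    refine ⟨S ∪ B, ?_, subset_union_left, ?_⟩
    · rw [mem_perfectMatchings, ← hV]
      exact hS.union hB hd
    · rw [union_sdiff_left, Finset.sdiff_eq_self_iff_disjoint]
      exact (hS.disjoint_of_disjoint hB hd).symm

/-- Hence a subfamily of the star of `S` has its link inside `PM(V ∖ D)`. [cite: KupavskiiZakharov2022, §2 (p. 6)] -/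
theorem link_subset_perfectMatchings {V D : Finset α} {S : Finset (Sym2 α)} (hS : IsPMOn D S) (hDV : D ⊆ V)
    {ℱ : Finset (Finset (Sym2 α))} (hℱ : ℱ ⊆ perfectMatchings V) :
    link ℱ S ⊆ perfectMatchings (V \ D) := by
  rw [← link_perfectMatchings_eq hS hDV]
  exact link_mono hℱ S

/-- **S2's homogeneity bookkeeping**: a family `ℱ` of perfect matchings of `V` all containing the partial
matching `S` (of `D`) that is `(PM(V)(S), τ)`-homogeneous — e.g. a piece of the Kupavskii–Zakharov spread
approximation with core `S` — has a link `{M ∖ S}` that is `(PM(V ∖ D), τ)`-homogeneous: the reduced family is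
`τ`-homogeneous among the perfect matchings of the reduced vertex set. [cite: KupavskiiZakharov2022, Lemma 11 (ii)] -/
theorem isRelHomogeneous_link_perfectMatchings {τ : ℝ} (hτ : 0 ≤ τ) {V D : Finset α} {S : Finset (Sym2 α)}
    (hS : IsPMOn D S) (hDV : D ⊆ V) {ℱ : Finset (Finset (Sym2 α))} (hℱS : ∀ M ∈ ℱ, S ⊆ M)
    (h : IsRelHomogeneous τ (supersets (perfectMatchings V) S) ℱ) :
    IsRelHomogeneous τ (perfectMatchings (V \ D)) (link ℱ S) := by
  rw [← link_perfectMatchings_eq hS hDV]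
  exact h.link hτ hℱS

/-- **Relabelling the reduced instance**: transporting along a map `g` injective on `V` with `g(V) = V'`,
a `(PM(V), τ)`-homogeneous family of perfect matchings of `V` becomes a `(PM(V'), τ)`-homogeneous family of
perfect matchings of `V'` of the same size (`τ ≥ 0`). [cite: KupavskiiZakharov2022, §2 (definition; invariant under renaming)] -/
theorem isRelHomogeneous_perfectMatchings_image {β : Type*} [DecidableEq β] {τ : ℝ} (hτ : 0 ≤ τ)
    {V : Finset α} {V' : Finset β} {𝒢 : Finset (Finset (Sym2 α))} (h𝒢 : 𝒢 ⊆ perfectMatchings V)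
    (h : IsRelHomogeneous τ (perfectMatchings V) 𝒢) (g : α → β) (hg : Set.InjOn g ↑V) (hgV : V.image g = V') :
    IsRelHomogeneous τ (perfectMatchings V') (𝒢.image (Finset.image (Sym2.map g))) ∧
      𝒢.image (Finset.image (Sym2.map g)) ⊆ perfectMatchings V' ∧
      #(𝒢.image (Finset.image (Sym2.map g))) = #𝒢 := by
  have hE : Set.InjOn (Sym2.map g) ↑(V.sym2) := fun e₁ h₁ e₂ h₂ heq =>
    sym2Map_injOn hg (mem_coe.1 h₁) (mem_coe.1 h₂) heq
  have hmem : ∀ M ∈ perfectMatchings V, M ⊆ V.sym2 := fun M hM => (mem_perfectMatchings.1 hM).subset_sym2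
  have himg : (perfectMatchings V).image (Finset.image (Sym2.map g)) = perfectMatchings V' := by
    rw [← hgV, perfectMatchings_image V g hg]
  refine ⟨?_, ?_, ?_⟩
  · rw [← himg]
    exact h.image_image hτ hE hmem (fun M hM => hmem M (h𝒢 hM))
  · rw [← himg]
    exact image_subset_image h𝒢
  · exact card_image_of_injOn ((image_sym2Map_injOn V g hg).mono (coe_subset.2 h𝒢))

end MatchingLinks

/-- **An edge set contained in a perfect matching is a perfect matching of its support.**
[cite: Rothvoss2017, §2 (PDF p. 6: perfect matchings as edge sets)] -/
theorem isPMOn_verts {S M : Finset (Sym2 (Fin n))} (hM : IsPMOn (univ : Finset (Fin n)) M) (hSM : S ⊆ M) :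
    IsPMOn (verts S) S := by
  refine ⟨fun e he => mem_sym2_iff.2 fun v hv => mem_verts.2 ⟨e, he, hv⟩, fun e he => hM.not_isDiag (hSM he),
    fun v hv => ?_⟩
  obtain ⟨e, he, hve⟩ := mem_verts.1 hv
  rw [card_eq_one]
  refine ⟨e, ?_⟩
  ext e'
  simp only [mem_filter, mem_singleton]
  constructor
  · rintro ⟨he', hve'⟩
    exact hM.unique (hSM he') (hSM he) hve' hve
  · rintro rfl
    exact ⟨he, hve⟩

/-- **S2 for `K_n`, packaged**: a family `ℱ` of perfect matchings of `K_n` all containing the partial matching `S`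
(e.g. a Kupavskii–Zakharov piece with core `S`) that is `(PM_n(S), τ)`-homogeneous yields, on deleting `S` and the
`2|S|` matched vertices `verts S`, a family `link ℱ S` of perfect matchings of the remaining vertices that is
`(PM(univ ∖ verts S), τ)`-homogeneous and has `|ℱ|` members; `isRelHomogeneous_perfectMatchings_image` then moves
it to `K_{n''}`. [cite: KupavskiiZakharov2022, Lemma 11 (ii)] -/
theorem isRelHomogeneous_link_univ {τ : ℝ} (hτ : 0 ≤ τ) {ℱ : Finset (Finset (Sym2 (Fin n)))}
    {S : Finset (Sym2 (Fin n))} (hℱ : ℱ ⊆ perfectMatchings univ) (hne : ℱ.Nonempty) (hℱS : ∀ M ∈ ℱ, S ⊆ M)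
    (h : IsRelHomogeneous τ (supersets (perfectMatchings univ) S) ℱ) :
    IsRelHomogeneous τ (perfectMatchings (univ \ verts S)) (link ℱ S) ∧
      link ℱ S ⊆ perfectMatchings (univ \ verts S) ∧ #(link ℱ S) = #ℱ := by
  obtain ⟨M, hM⟩ := hne
  have hS : IsPMOn (verts S) S := isPMOn_verts (mem_perfectMatchings.1 (hℱ hM)) (hℱS M hM)
  exact ⟨isRelHomogeneous_link_perfectMatchings hτ hS (subset_univ _) hℱS h,
    link_subset_perfectMatchings hS (subset_univ _) hℱ,
    by rw [card_link, supersets_eq_self_of_forall hℱS]⟩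

end Literature.Combinatorics.AssociationSchemes.HomogeneousMatchingFamilies
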